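import Summits.AtomisticToContinuum.HydrodynamicLimit.Theorems.AntiMazurCoboundariesCorrectorPressureDecayKiferWall
import Summits.AtomisticToContinuum.HydrodynamicLimit.Theorems.AntiMazurCoboundariesKineticFluxLdDecayGibbsTiltUnprofitable
import Summits.AtomisticToContinuum.HydrodynamicLimit.Theses.FluxGibbsianityLdDrude
import HarnessLib

/-!
# Skeleton — crux `KineticFluxLdDecay` (stmt-AtomisticToContinuum-10967), ALTERNATIVE line
# `kinetic-local-ergodicity` (crux-strategist `planner-cstrat-stmt-AtomisticToContinuum-10967-s1-0`, 2026-08-17)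

**Lens: transfer (Olla–Varadhan–Yau 1993 §4, the deterministic steps) + strengthen-to-rigidity.**
This line does NOT touch the live skeleton `Lines/h_theorem_dissipation_budget.lean` (lead a2, bet
`stub_noPerpetualDissipationTilt`). It rides on the compactness road LANDED today on the Lean-equivalent sibling crux
stmt-14135 (`Theorems/AntiMazurCoboundariesCorrectorPressureDecayKifer*.lean`, lead 14135-a1, all ACCEPTED):

* finite `N`: `KiferCompactification.stub_reduction : AlmostStationaryDualDecay → KineticFluxLdDecay` (Kifer's
  upper bound: Gibbs variational identity + time-averaged optimal tilt, `(2/τ)`-almost stationary);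
* `N = ∞`: tangent families / tangent states (`IsTangentFamily`, `IsTangentState`), the three INFRASTRUCTURE
  statements `TangentTightness`, `TangentBias`, `TangentEntropyLowDensity` (Kallenberg 16.15–16.16, OVY 1993
  Lemmas 4.1–4.2, Georgii–Zessin 1993, Ruelle 1969 §4 — typed, open) and the bridge
  `stub_tangentAssemblyLaw : T → B → E → EntropicBoltzmannPropertyTangent → ASDD`.

Its wall there is the ENTROPIC BOLTZMANN PROPERTY `EntropicBoltzmannPropertyTangent` (EBPT): a variational
inequality `ofReal |fast one-body bias| ≤ h(μ | G)` for every admissible `g` at ONE small amplitude.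

**The new lever of THIS line** is to replace that variational wall by the STRUCTURAL statement every classification
engine actually proves — the deterministic replacement of OVY's noise step (B) ("conditioned on the positions the
momenta are mixtures of Maxwellian products", OVY 1993 §4 step (B), j. p. 540), at the one-body level:

  `OneBodyMaxwellMixtureTangent` (KINETIC LOCAL ERGODICITY, one-body form): the normalised one-body velocity law of
  every translation-invariant tangent state `μ` is a scale–location GAUSSIAN MIXTURE `∫ N(u₁, θ₁) dπ(u₁, θ₁)` whose
  Maxwellian entropy is PAID FOR by the specific relative entropy: `∫ KL(N(u₁,θ₁) ‖ N(0,1)) dπ ≤ h(μ | G)`.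

No observable `g`, no orthogonality, no amplitude appears in the wall: the amplitude `κ ≤ 1/4` and the orthogonality
`g ⊥ {1, v, |v|²}` are consumed ONCE, by the landed statics `KineticFluxLdDecayTilt.tiltFunctional_nonpos_of_abs_le_quarter`
(p127691: Gibbs tilts are unprofitable at amplitude `1/4`), in the PROVED glue
`entropicBoltzmannPropertyTangent_of_oneBodyMaxwellMixture : OneBodyMaxwellMixtureTangent → EBPT` below.
Both recorded artefacts that cost the live line two reshapes are exact NON-witnesses here: the macrostate mixture
`½(G⁺ + G⁻)` has `π = ½δ_{(0,1+Δ)} + ½δ_{(0,1−Δ)}` with entropy EQUALITY, and no nonlinear functional of a one-body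
DENSITY is ever evaluated (no point-density artefact).

Registered stubs of THIS file (sorries ONLY here):
* `stub_tangentTightness : TangentTightness`, `stub_tangentBias : TangentBias`,
  `stub_tangentEntropyLowDensity : TangentEntropyLowDensity` — infrastructure, SHARED verbatim with line `FirstLemma`
  of stmt-14135 (whoever lands them closes both lines' copies by name);
* `stub_oneBodyMaxwellMixtureTangent : OneBodyMaxwellMixtureTangent` — THE WALL of this line (open; the qualitative,
  rate-free, `N`-free kinetic local ergodic theorem for deterministic hard spheres at low density, one-body level).

Composition `KineticFluxLdDecay_of` / `KineticFluxLdDecay_of'` (both route copies, BY NAME) =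
`stub_reduction ∘ stub_tangentAssemblyLaw ∘ (proved glue)`; sorry-free below the stubs.

Disproof.lean (v3) honoured: `⊥ 1, ⊥ v, ⊥ |v|²` and the amplitude clause are used exactly in the glue (the statics
need all four: `kineticFluxLdDecay_false_without_orthVel/_orthEnergy/_allAmplitudes`); `|φ| ≤ 1` is consumed by the
landed bridge (`φ = φ⁺ − φ⁻` at doubled amplitude). No `-- Targets` entry or landed `Negative/` lemma bears on the stubs.
-/

noncomputable section

open MeasureTheory ProbabilityTheory Set Filter Topology
open scoped ENNReal

namespace Summit.AtomisticToContinuum.HydrodynamicLimit.Cruxes.KineticFluxLdDecay.KineticLocalErgodicity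

open Literature.MathematicalPhysics.KineticTheory (T3 V3 hsDiameter localGibbsLaw)
open Literature.MathematicalPhysics.KineticTheory.PointProcess (laplaceFunctional specificRelEntropy)
open Literature.Analysis.FluidPDE (HardSphereFlow Config IsHardSphereGibbs IsTranslationInvariant windowSumReal)
open Literature.Analysis.FunctionSpaces (PointConfig)
open Summit.AtomisticToContinuum.HydrodynamicLimit.Theorems.KiferCompactification
open Summit.AtomisticToContinuum.HydrodynamicLimit.Theorems.KineticFluxLdDecayTilt
  (llr1 tiltFunctional_nonpos_of_abs_le_quarter integrable_comp_shift_of_abs_le integrable_llr1_comp_shift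
   integral_llr1_comp_shift)

/-! ## The wall: kinetic local ergodicity at the one-body level (posited statement of this line) -/

/-- **KINETIC LOCAL ERGODICITY FOR TANGENT STATES, ONE-BODY FORM** (`C⁺` of line `kinetic-local-ergodicity`): for every
`θ, u₀` there are `z₀, κ > 0` such that for every translation-invariant tangent state `μ` of an entropy-`κ` tangent
family (in the frame of `KiferCompactification`) and every translation-invariant hard-sphere Gibbs reference `G` of
activity `z < z₀`, inverse temperature `θ⁻¹`, drift `u₀`, there is a FINITE measure `π` on drift–temperature parameters
`(u₁, θ₁) ∈ ℝ³ × (0, ∞)` (normalised coordinates `w = (v − u₀)/√θ`) with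
(i) the one-body velocity functional of `μ` per unit volume is the Gaussian mixture
`E_μ[Σ_{p ∈ ω ∩ [0,1)³×ℝ³} t((p.2 − u₀)/√θ)] = ∫ E_{N(u₁,θ₁)} t dπ` for every continuous `|t| ≤ 1`, and
(ii) ENTROPY DOMINATION `∫ KL(N(u₁,θ₁) ‖ N(0,1)) dπ = ∫ (‖u₁‖²/2 + (3/2)(θ₁ − 1 − log θ₁)) dπ ≤ h(μ | G)` in `[0, ∞]`.
The deterministic, one-body replacement of OVY 1993 §4 step (B); strictly stronger than `EntropicBoltzmannPropertyTangent`
(glue below); open (Boltzmann-hypothesis barrier, narrowed form, scope caveat (b): absence of proof, no printed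
obstruction). The natural conjecture is the same for EVERY entropy budget `κ`; only `∃ κ` is needed and posited.
Posited, never asserted. -/
def OneBodyMaxwellMixtureTangent : Prop :=
  ∀ (θ : ℝ) (u₀ : V3), 0 < θ → ∃ z₀ : ℝ, 0 < z₀ ∧ ∃ κ : ℝ, 0 < κ ∧
  ∀ (σ a : ℝ), 0 < σ → 0 < a →
  ∀ (φ : T3 → ℝ), Continuous φ → (∀ x, 0 ≤ φ x) → (∀ x, φ x ≤ 1) → 0 < ∫ x, φ x →
  ∀ (N : ℕ → ℕ)
    (Φ : ∀ k, HardSphereFlow (Literature.Analysis.FluidPDE.Torus.geometry (Fin 3)) (hsDiameter σ (N k)) (N k + 1))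
    (Q : ∀ k, Measure (Config (N k + 1) (Fin 3) T3)),
    IsTangentFamily σ a θ u₀ κ N Φ Q →
    ∀ (ι : ℕ → ℕ) (μ : Measure (PointConfig (V3 × V3))), IsTangentState σ φ N Q ι μ →
      IsProbabilityMeasure μ → IsTranslationInvariant μ →
    ∀ (z : ℝ) (G : Measure (PointConfig (V3 × V3))), 0 < z → z < z₀ →
      IsHardSphereGibbs 1 z θ⁻¹ u₀ G → IsTranslationInvariant G →
    ∃ π : Measure (V3 × ℝ), IsFiniteMeasure π ∧ (∀ᵐ q ∂π, 0 < q.2) ∧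
      (∀ t : V3 → ℝ, Continuous t → (∀ v, |t v| ≤ 1) →
        ∫ ω, windowSumReal ω (Literature.Analysis.FunctionSpaces.Torus.unitCube (Fin 3))
            (fun p => t ((Real.sqrt θ)⁻¹ • (p.2 - u₀))) ∂μ =
          ∫ q, (∫ w, t (q.1 + Real.sqrt q.2 • w) ∂(stdGaussian V3)) ∂π) ∧
      ∫⁻ q, ENNReal.ofReal (‖q.1‖ ^ 2 / 2 + 3 / 2 * (q.2 - 1 - Real.log q.2)) ∂π ≤ specificRelEntropy μ G

/-! ## Registered stubs -/

/-- STUB (infrastructure, shared with line `FirstLemma` of stmt-14135): tightness of tangent families. -/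
theorem stub_tangentTightness : TangentTightness := by
  sorry

/-- STUB (infrastructure, shared with line `FirstLemma` of stmt-14135): continuity of the one-body bias. -/
theorem stub_tangentBias : TangentBias := by
  sorry

/-- STUB (infrastructure, shared with line `FirstLemma` of stmt-14135): low-density entropy lower semicontinuity. -/
theorem stub_tangentEntropyLowDensity : TangentEntropyLowDensity := by
  sorry

/-- STUB — THE WALL of this line (lead): kinetic local ergodicity for tangent states, one-body form. -/
theorem stub_oneBodyMaxwellMixtureTangent : OneBodyMaxwellMixtureTangent := by
  sorry

/-! ## Proved glue (sorry-free below this line) -/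

/-- A tangent family with a smaller entropy budget is a tangent family with a larger one. -/
theorem isTangentFamily_mono {σ a θ : ℝ} {u₀ : V3} {κ κ' : ℝ} {N : ℕ → ℕ}
    {Φ : ∀ k, HardSphereFlow (Literature.Analysis.FluidPDE.Torus.geometry (Fin 3)) (hsDiameter σ (N k)) (N k + 1)}
    {Q : ∀ k, Measure (Config (N k + 1) (Fin 3) T3)}
    (h : IsTangentFamily σ a θ u₀ κ' N Φ Q) (hle : κ' ≤ κ) : IsTangentFamily σ a θ u₀ κ N Φ Q := by
  obtain ⟨h1, h2, h3, h4⟩ := h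
  refine ⟨h1, h2, fun k => (h3 k).trans (ENNReal.ofReal_le_ofReal ?_), h4⟩
  exact mul_le_mul_of_nonneg_right hle (by positivity)

/-- STATICS, pointwise (landed p127691 + TiltWitnessCalc): for `g` continuous, `|g| ≤ 1/4`, `g ⊥ span{1, v, |v|²}`, every
drift `u₁` and temperature `θ₁ > 0`, the Gibbs-tilt gain is dominated by the Maxwellian relative entropy:
`|E_{N(u₁,θ₁)} g| ≤ KL(N(u₁,θ₁) ‖ N(0,1)) = ‖u₁‖²/2 + (3/2)(θ₁ − 1 − log θ₁)`. -/
theorem abs_gain_le_gaussKL {g : V3 → ℝ} (hg : Continuous g) (hgq : ∀ v, |g v| ≤ 1 / 4)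
    (horth : ∀ (c₀ c₂ : ℝ) (b : V3), ∫ v, g v * (c₀ + inner ℝ b v + c₂ * ‖v‖ ^ 2) ∂(stdGaussian V3) = 0)
    (u₁ : V3) {θ₁ : ℝ} (hθ₁ : 0 < θ₁) :
    |∫ w, g (u₁ + Real.sqrt θ₁ • w) ∂(stdGaussian V3)| ≤
      ‖u₁‖ ^ 2 / 2 + 3 / 2 * (θ₁ - 1 - Real.log θ₁) := by
  -- one-sided bound for any admissible `g'`
  have key : ∀ g' : V3 → ℝ, Continuous g' → (∀ v, |g' v| ≤ 1 / 4) →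
      (∀ (c₀ c₂ : ℝ) (b : V3), ∫ v, g' v * (c₀ + inner ℝ b v + c₂ * ‖v‖ ^ 2) ∂(stdGaussian V3) = 0) →
      ∫ w, g' (u₁ + Real.sqrt θ₁ • w) ∂(stdGaussian V3) ≤ ‖u₁‖ ^ 2 / 2 + 3 / 2 * (θ₁ - 1 - Real.log θ₁) := by
    intro g' hg' hg'q horth'
    have h1 := tiltFunctional_nonpos_of_abs_le_quarter hg' hg'q horth' u₁ hθ₁
    rw [integral_add (integrable_comp_shift_of_abs_le hg' hg'q u₁ θ₁) (integrable_llr1_comp_shift hθ₁ u₁),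
      integral_llr1_comp_shift hθ₁ u₁] at h1
    linarith
  have hup := key g hg hgq horth
  have hneg_orth : ∀ (c₀ c₂ : ℝ) (b : V3),
      ∫ v, (-g v) * (c₀ + inner ℝ b v + c₂ * ‖v‖ ^ 2) ∂(stdGaussian V3) = 0 := by
    intro c₀ c₂ b
    simp only [neg_mul, integral_neg, horth, neg_zero]
  have hdown := key (fun v => -g v) hg.neg (fun v => by rw [abs_neg]; exact hgq v) hneg_orth
  rw [integral_neg] at hdown
  exact abs_le.2 ⟨by linarith, hup⟩

/-- **GLUE (proved): kinetic local ergodicity at the one-body level implies the Entropic Boltzmann Property for tangent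
states.** Amplitude `κ := min κ_KLE (1/4)`; represent the bias through the Gaussian mixture `π`, bound the gain fibrewise by
the Maxwellian relative entropy (`abs_gain_le_gaussKL`), and integrate in `[0, ∞]`. -/
theorem entropicBoltzmannPropertyTangent_of_oneBodyMaxwellMixture (h : OneBodyMaxwellMixtureTangent) :
    EntropicBoltzmannPropertyTangent := by
  intro θ u₀ hθ
  obtain ⟨z₀, hz₀, κ, hκ, hmain⟩ := h θ u₀ hθ
  refine ⟨z₀, hz₀, min κ (1 / 4), by positivity, ?_⟩
  intro σ a hσ ha φ hφ hφ0 hφ1 hφi N Φ Q hfam ι μ hμ hμP hμT z G hz hzz₀ hG hGT g hg hgκ horth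
  have hfam' : IsTangentFamily σ a θ u₀ κ N Φ Q := isTangentFamily_mono hfam (min_le_left _ _)
  obtain ⟨π, hπfin, hπpos, hrep, hent⟩ :=
    hmain σ a hσ ha φ hφ hφ0 hφ1 hφi N Φ Q hfam' ι μ hμ hμP hμT z G hz hzz₀ hG hGT
  have hgq : ∀ v, |g v| ≤ 1 / 4 := fun v => (hgκ v).trans (min_le_right _ _)
  have hg1 : ∀ v, |g v| ≤ 1 := fun v => (hgq v).trans (by norm_num)
  rw [hrep g hg hg1]
  -- notation for the fibre gain and the fibre entropy
  set E : V3 × ℝ → ℝ := fun q => ∫ w, g (q.1 + Real.sqrt q.2 • w) ∂(stdGaussian V3) with hE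
  set A : V3 × ℝ → ℝ := fun q => ‖q.1‖ ^ 2 / 2 + 3 / 2 * (q.2 - 1 - Real.log q.2) with hA
  have hpt : ∀ᵐ q ∂π, |E q| ≤ A q := by
    filter_upwards [hπpos] with q hq
    exact abs_gain_le_gaussKL hg hgq horth q.1 hq
  calc ENNReal.ofReal |∫ q, E q ∂π|
      ≤ ∫⁻ q, ENNReal.ofReal |E q| ∂π := by
        have h1 : ‖∫ q, E q ∂π‖ ≤ ENNReal.toReal (∫⁻ q, ENNReal.ofReal ‖E q‖ ∂π) :=
          norm_integral_le_lintegral_norm E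
        simp only [Real.norm_eq_abs] at h1
        exact (ENNReal.ofReal_le_ofReal h1).trans ENNReal.ofReal_toReal_le
    _ ≤ ∫⁻ q, ENNReal.ofReal (A q) ∂π := lintegral_mono_ae (hpt.mono fun q hq => ENNReal.ofReal_le_ofReal hq)
    _ ≤ specificRelEntropy μ G := hent

/-! ## Composition (BY NAME, both route copies) -/

/-- The four stub STATEMENTS imply the crux (route `AntiMazurCoboundaries`' copy, by name): proved glue, then the landed
bridge `stub_tangentAssemblyLaw` (p139810) and Kifer's finite-volume upper bound `stub_reduction` (p138320). -/
theorem KineticFluxLdDecay_of_parts (hT : TangentTightness) (hB : TangentBias) (hE : TangentEntropyLowDensity)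
    (hK : OneBodyMaxwellMixtureTangent) :
    Summit.AtomisticToContinuum.HydrodynamicLimit.Theses.AntiMazurCoboundaries.KineticFluxLdDecay :=
  stub_reduction (stub_tangentAssemblyLaw hT hB hE (entropicBoltzmannPropertyTangent_of_oneBodyMaxwellMixture hK))

/-- **Composition** (route `AntiMazurCoboundaries`' copy of the crux, BY NAME). -/
theorem KineticFluxLdDecay_of :
    Summit.AtomisticToContinuum.HydrodynamicLimit.Theses.AntiMazurCoboundaries.KineticFluxLdDecay :=
  KineticFluxLdDecay_of_parts stub_tangentTightness stub_tangentBias stub_tangentEntropyLowDensity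
    stub_oneBodyMaxwellMixtureTangent

/-- The two routes' copies of the shared crux are the same term. -/
theorem kineticFluxLdDecay_routes_eq :
    Summit.AtomisticToContinuum.HydrodynamicLimit.Theses.FluxGibbsianityLdDrude.KineticFluxLdDecay =
      Summit.AtomisticToContinuum.HydrodynamicLimit.Theses.AntiMazurCoboundaries.KineticFluxLdDecay :=
  rfl

/-- **Composition** (route `FluxGibbsianityLdDrude`'s copy of the crux, BY NAME). -/
theorem KineticFluxLdDecay_of' :
    Summit.AtomisticToContinuum.HydrodynamicLimit.Theses.FluxGibbsianityLdDrude.KineticFluxLdDecay :=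
  kineticFluxLdDecay_routes_eq ▸ KineticFluxLdDecay_of

end Summit.AtomisticToContinuum.HydrodynamicLimit.Cruxes.KineticFluxLdDecay.KineticLocalErgodicity

end
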